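import Mathlib
import HarnessLib

/-!
# The van der Corput inequality on a finite abelian group (Fejér-weighted form)

Support file (everything PROVED; no definitions, no named facts) towards the named fact
`Literature.NumberTheory.Sieve.teravainen2024_cor_2_1` (J. Teräväinen, *On the Liouville function
at polynomial arguments*, Amer. J. Math. 146 (2024) = arXiv:2010.07924, Corollary 2.1 ⊂
Theorem 2.6, proved in §5). The proof of Proposition 5.3 there (§5.3, "the case of arbitrary
`σ(d)`", p. 14) applies "van der Corput's inequality (see e.g. [Green–Tao, *The quantitative
behaviour of polynomial orbits on nilmanifolds*]) in the form

> `|𝔼_{n∈ℤ_N} a(n)|² ≤ Re(2𝔼_{ℓ∈ℤ_N, 1≤ℓ≤L} (1 - ℓ/L) 𝔼_{n∈ℤ_N} a(n) \overline{a(n+ℓ)}) + O(1/L + L/N)`."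

On a finite abelian group `G` (in print `G = ℤ_N`) the inequality holds without the `L/N` term,
by the exact translation invariance of `𝔼_{n∈G}`; this file proves it in that form, for any
`a : G → ℂ`, any step `v ∈ G` (in print `v = 1 ∈ ℤ_N`) and any `L ≥ 1`:

* `Teravainen2024.vanDerCorput_sum` —
  `L² ‖∑_n a(n)‖² ≤ #G · (L ∑_n ‖a(n)‖² + 2 ∑_{1≤ℓ<L} (L - ℓ) Re ∑_n a(n) \overline{a(n + ℓv)})`;
* `Teravainen2024.vanDerCorput_expect` — for `1`-bounded `a`, the printed normalisation
  `‖𝔼_n a(n)‖² ≤ 1/L + (2/L) ∑_{1≤ℓ<L} (1 - ℓ/L) Re 𝔼_n a(n) \overline{a(n + ℓv)}`.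

The proof is the textbook one: `∑_n a(n) = (1/L) ∑_n ∑_{j<L} a(n + jv)`, Cauchy–Schwarz in `n`,
expansion of `|∑_{j<L} a(n+jv)|²`, translation `n ↦ n - jv`, and the count
`#{(j,j') ∈ [0,L)² : |j - j'| = ℓ} = 2(L - ℓ)` (`Teravainen2024.sum_sum_natDist_eq`).

## References
* J. Teräväinen, Amer. J. Math. 146 (2024), no. 4, 1115–1167, §5.3, proof of Proposition 5.3,
  display after (5.16) (arXiv:2010.07924, p. 14). [Teravainen2024]
* B. Green, T. Tao, Ann. of Math. 175 (2012), 465–540, Lemma 4.1 (van der Corput) — cited there.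
-/

noncomputable section

open Finset Complex

namespace Literature.NumberTheory.Sieve

namespace Teravainen2024

/-- Counting pairs by their distance: for `T : ℕ → ℝ`,
`∑_{j,j'<L} T(|j - j'|) = 2 ∑_{ℓ<L} (L - ℓ) T(ℓ) - L·T(0)`
(`= L T(0) + 2 ∑_{1≤ℓ<L} (L-ℓ) T(ℓ)`). [folklore] -/
theorem sum_sum_natDist_eq (T : ℕ → ℝ) (L : ℕ) :
    ∑ j ∈ range L, ∑ j' ∈ range L, T (Int.natAbs ((j : ℤ) - j')) =
      2 * ∑ ℓ ∈ range L, ((L : ℝ) - ℓ) * T ℓ - L * T 0 := by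
  induction L with
  | zero => simp
  | succ L ih =>
    -- peel off `j = L` and `j' = L`
    have hrow : ∀ j ∈ range L, ∑ j' ∈ range (L + 1), T (Int.natAbs ((j : ℤ) - j')) =
        ∑ j' ∈ range L, T (Int.natAbs ((j : ℤ) - j')) + T (L - j) := by
      intro j hj
      rw [Finset.sum_range_succ]
      congr 2
      rw [Finset.mem_range] at hj
      omega
    have hlast : ∑ j' ∈ range (L + 1), T (Int.natAbs ((L : ℤ) - j')) =
        ∑ j' ∈ range L, T (L - j') + T 0 := by
      rw [Finset.sum_range_succ]
      congr 1
      · refine Finset.sum_congr rfl fun j' hj' => ?_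
        rw [Finset.mem_range] at hj'
        congr 1
        omega
      · simp
    rw [Finset.sum_range_succ, Finset.sum_congr rfl hrow, Finset.sum_add_distrib, ih, hlast]
    -- the two cross sums are `∑_{ℓ<L} T(ℓ+1)`
    have hrefl : ∑ j ∈ range L, T (L - j) = ∑ ℓ ∈ range L, T (ℓ + 1) := by
      rw [← Finset.sum_range_reflect (fun j => T (L - j)) L]
      refine Finset.sum_congr rfl fun ℓ hℓ => ?_
      rw [Finset.mem_range] at hℓ
      congr 1
      omega
    rw [hrefl]
    -- compare with the right-hand side at `L + 1`
    rw [Finset.sum_range_succ (fun ℓ => (((L + 1 : ℕ) : ℝ) - ℓ) * T ℓ)]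
    have h1 : ∑ ℓ ∈ range L, (((L + 1 : ℕ) : ℝ) - ℓ) * T ℓ =
        ∑ ℓ ∈ range L, ((L : ℝ) - ℓ) * T ℓ + ∑ ℓ ∈ range L, T ℓ := by
      rw [← Finset.sum_add_distrib]
      refine Finset.sum_congr rfl fun ℓ _ => ?_
      push_cast
      ring
    have h2 : ∑ ℓ ∈ range L, T ℓ = (∑ ℓ ∈ range L, T (ℓ + 1)) + T 0 - T L := by
      have h := Finset.sum_range_succ' (fun ℓ => T ℓ) L
      have h' := Finset.sum_range_succ (fun ℓ => T ℓ) L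
      linarith
    rw [h1, h2]
    push_cast
    ring

variable {G : Type*} [AddCommGroup G] [Fintype G]

/-- Translation invariance of `∑_{n∈G}`. [folklore] -/
theorem sum_add_right_eq (f : G → ℂ) (c : G) : ∑ n, f (n + c) = ∑ n, f n :=
  Fintype.sum_equiv (Equiv.addRight c) _ _ fun _ => rfl

/-- The shifted autocorrelations are Hermitian:
`Re ∑_n a(n + jv) \overline{a(n + j'v)} = Re ∑_n a(n) \overline{a(n + |j-j'| v)}`. [folklore] -/
theorem re_sum_shift_mul_conj_shift (a : G → ℂ) (v : G) (j j' : ℕ) :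
    (∑ n, a (n + j • v) * (starRingEnd ℂ) (a (n + j' • v))).re =
      (∑ n, a n * (starRingEnd ℂ) (a (n + Int.natAbs ((j : ℤ) - j') • v))).re := by
  rcases le_total j j' with hjj | hjj
  · -- `j ≤ j'`: translate `n ↦ n - jv`
    have hℓ : Int.natAbs ((j : ℤ) - j') = j' - j := by omega
    rw [hℓ]
    have h := sum_add_right_eq (fun n => a n * (starRingEnd ℂ) (a (n + (j' - j) • v))) (j • v)
    rw [← h]
    congr 1
    refine Finset.sum_congr rfl fun n _ => ?_
    congr 3
    rw [add_assoc, ← add_nsmul, Nat.add_sub_cancel' hjj]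
  · -- `j' ≤ j`: translate `n ↦ n - j'v` and conjugate
    have hℓ : Int.natAbs ((j : ℤ) - j') = j - j' := by omega
    rw [hℓ]
    have h := sum_add_right_eq (fun n => a (n + (j - j') • v) * (starRingEnd ℂ) (a n)) (j' • v)
    have h2 : ∑ n, a (n + j • v) * (starRingEnd ℂ) (a (n + j' • v)) =
        ∑ n, a (n + j' • v + (j - j') • v) * (starRingEnd ℂ) (a (n + j' • v)) := by
      refine Finset.sum_congr rfl fun n _ => ?_
      rw [add_assoc, ← add_nsmul, Nat.add_sub_cancel' hjj]
    rw [h2, h]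
    -- `∑ a(n + ℓv) conj a(n) = conj (∑ a(n) conj a(n + ℓv))`
    have h3 : ∑ n, a (n + (j - j') • v) * (starRingEnd ℂ) (a n) =
        (starRingEnd ℂ) (∑ n, a n * (starRingEnd ℂ) (a (n + (j - j') • v))) := by
      rw [map_sum]
      refine Finset.sum_congr rfl fun n _ => ?_
      rw [map_mul, Complex.conj_conj, mul_comm]
    rw [h3, Complex.conj_re]

/-- **van der Corput's inequality on a finite abelian group** (Fejér-weighted, exact): for
`a : G → ℂ`, a step `v ∈ G` and `L ≥ 1`,
`L² ‖∑_n a(n)‖² ≤ #G · (L ∑_n ‖a(n)‖² + 2 ∑_{1≤ℓ<L} (L - ℓ) Re ∑_n a(n) \overline{a(n+ℓv)})`.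
[cite: Teravainen2024, §5.3 (proof of Proposition 5.3, display after (5.16))] -/
theorem vanDerCorput_sum (a : G → ℂ) (v : G) {L : ℕ} (hL : 1 ≤ L) :
    (L : ℝ) ^ 2 * ‖∑ n, a n‖ ^ 2 ≤
      (Fintype.card G : ℝ) * ((L : ℝ) * ∑ n, ‖a n‖ ^ 2 +
        2 * ∑ ℓ ∈ Ico 1 L, ((L : ℝ) - ℓ) *
          (∑ n, a n * (starRingEnd ℂ) (a (n + ℓ • v))).re) := by
  -- (1) `L ∑ a = ∑_n ∑_{j<L} a(n + jv)`
  set b : G → ℂ := fun n => ∑ j ∈ range L, a (n + j • v) with hb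
  have h1 : (L : ℂ) * ∑ n, a n = ∑ n, b n := by
    rw [hb]
    simp only
    rw [Finset.sum_comm]
    rw [Finset.sum_congr rfl fun j _ => sum_add_right_eq a (j • v)]
    rw [Finset.sum_const, Finset.card_range, nsmul_eq_mul]
  -- (2) Cauchy–Schwarz: `‖∑_n b n‖² ≤ #G ∑_n ‖b n‖²`
  have h2 : ‖∑ n, b n‖ ^ 2 ≤ (Fintype.card G : ℝ) * ∑ n, ‖b n‖ ^ 2 := by
    have hcs := Finset.sum_mul_sq_le_sq_mul_sq (Finset.univ : Finset G) (fun _ => (1 : ℝ))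
      (fun n => ‖b n‖)
    simp only [one_pow, Finset.sum_const, Finset.card_univ, nsmul_eq_mul, mul_one, one_mul] at hcs
    calc ‖∑ n, b n‖ ^ 2 ≤ (∑ n, ‖b n‖) ^ 2 := by
          gcongr
          exact norm_sum_le _ _
      _ ≤ (Fintype.card G : ℝ) * ∑ n, ‖b n‖ ^ 2 := hcs
  -- (3) expand `‖b n‖²` and translate
  set T : ℕ → ℝ := fun ℓ => (∑ n, a n * (starRingEnd ℂ) (a (n + ℓ • v))).re with hT
  have h3 : ∑ n, ‖b n‖ ^ 2 = ∑ j ∈ range L, ∑ j' ∈ range L, T (Int.natAbs ((j : ℤ) - j')) := by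
    have hexp : ∀ n, ‖b n‖ ^ 2 =
        ∑ j ∈ range L, ∑ j' ∈ range L, (a (n + j • v) * (starRingEnd ℂ) (a (n + j' • v))).re := by
      intro n
      have h : ((‖b n‖ ^ 2 : ℝ) : ℂ) = b n * (starRingEnd ℂ) (b n) := by
        rw [Complex.mul_conj, Complex.normSq_eq_norm_sq]
      have h' : b n * (starRingEnd ℂ) (b n) =
          ∑ j ∈ range L, ∑ j' ∈ range L, a (n + j • v) * (starRingEnd ℂ) (a (n + j' • v)) := by
        rw [hb]
        simp only
        rw [map_sum, Finset.sum_mul_sum]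
      have h'' := congrArg Complex.re (h.trans h')
      rw [Complex.ofReal_re] at h''
      rw [h'', Complex.re_sum]
      refine Finset.sum_congr rfl fun j _ => ?_
      rw [Complex.re_sum]
    simp only [hexp]
    rw [Finset.sum_comm]
    refine Finset.sum_congr rfl fun j _ => ?_
    rw [Finset.sum_comm]
    refine Finset.sum_congr rfl fun j' _ => ?_
    rw [← Complex.re_sum, re_sum_shift_mul_conj_shift a v j j']
  -- (4) count the pairs
  rw [sum_sum_natDist_eq T L] at h3
  -- `T 0 = ∑ ‖a n‖²`
  have hT0 : T 0 = ∑ n, ‖a n‖ ^ 2 := by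
    rw [hT]
    simp only [zero_smul, add_zero]
    rw [Complex.re_sum]
    refine Finset.sum_congr rfl fun n _ => ?_
    rw [Complex.mul_conj, Complex.normSq_eq_norm_sq]
    norm_cast
  -- `2 ∑_{ℓ<L} (L-ℓ) T ℓ - L T 0 = L T 0 + 2 ∑_{1≤ℓ<L} (L-ℓ) T ℓ`
  have hsplit : 2 * ∑ ℓ ∈ range L, ((L : ℝ) - ℓ) * T ℓ - L * T 0 =
      L * T 0 + 2 * ∑ ℓ ∈ Ico 1 L, ((L : ℝ) - ℓ) * T ℓ := by
    have h : ∑ ℓ ∈ range L, ((L : ℝ) - ℓ) * T ℓ =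
        ((L : ℝ) - (0 : ℕ)) * T 0 + ∑ ℓ ∈ Ico 1 L, ((L : ℝ) - ℓ) * T ℓ := by
      rw [Finset.range_eq_Ico]
      rw [← Finset.sum_eq_sum_Ico_succ_bot hL (fun ℓ => ((L : ℝ) - ℓ) * T ℓ)]
    rw [h]
    push_cast
    ring
  rw [hsplit] at h3
  -- (5) assemble
  have h5 : (L : ℝ) ^ 2 * ‖∑ n, a n‖ ^ 2 = ‖∑ n, b n‖ ^ 2 := by
    rw [← h1, norm_mul, Complex.norm_natCast, mul_pow]
  rw [h5, ← hT0, ← h3]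
  exact h2

/-- **van der Corput's inequality, printed normalisation** (Teräväinen 2024, §5.3): for a
`1`-bounded `a : G → ℂ` on a finite abelian group (`G = ℤ_N` in print), a step `v` and `L ≥ 1`,
`‖𝔼_n a(n)‖² ≤ 1/L + (2/L) ∑_{1≤ℓ<L} (1 - ℓ/L) Re 𝔼_n a(n) \overline{a(n+ℓv)}`
(the printed `O(1/L + L/N)` is `1/L` here: on a group there is no boundary term).
[cite: Teravainen2024, §5.3 (proof of Proposition 5.3, display after (5.16))] -/
theorem vanDerCorput_expect [Nonempty G] (a : G → ℂ) (ha : ∀ n, ‖a n‖ ≤ 1) (v : G) {L : ℕ}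
    (hL : 1 ≤ L) :
    ‖(∑ n, a n) / (Fintype.card G : ℂ)‖ ^ 2 ≤
      1 / L + 2 / L * ∑ ℓ ∈ Ico 1 L, (1 - (ℓ : ℝ) / L) *
        ((∑ n, a n * (starRingEnd ℂ) (a (n + ℓ • v))) / (Fintype.card G : ℂ)).re := by
  have hG : (0 : ℝ) < Fintype.card G := by exact_mod_cast Fintype.card_pos
  have hLR : (0 : ℝ) < L := by exact_mod_cast hL
  have h := vanDerCorput_sum a v hL
  -- `∑ ‖a n‖² ≤ #G`
  have hnorm : ∑ n, ‖a n‖ ^ 2 ≤ Fintype.card G := by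
    calc ∑ n, ‖a n‖ ^ 2 ≤ ∑ _n : G, (1 : ℝ) := Finset.sum_le_sum fun n _ => by
          have h1 := ha n
          have h0 := norm_nonneg (a n)
          nlinarith
      _ = Fintype.card G := by simp
  -- rewrite the real parts of the normalised correlations
  have hre : ∀ ℓ : ℕ, ((∑ n, a n * (starRingEnd ℂ) (a (n + ℓ • v))) / (Fintype.card G : ℂ)).re =
      (∑ n, a n * (starRingEnd ℂ) (a (n + ℓ • v))).re / Fintype.card G := by
    intro ℓ
    rw [← Complex.ofReal_natCast, Complex.div_ofReal_re]
  simp only [hre]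
  rw [norm_div, Complex.norm_natCast, div_pow]
  set B : ℝ := ∑ ℓ ∈ Ico 1 L, ((L : ℝ) - ℓ) * (∑ n, a n * (starRingEnd ℂ) (a (n + ℓ • v))).re
    with hB
  have h' : (L : ℝ) ^ 2 * ‖∑ n, a n‖ ^ 2 ≤
      (Fintype.card G : ℝ) * ((L : ℝ) * Fintype.card G + 2 * B) := by
    refine h.trans (mul_le_mul_of_nonneg_left ?_ hG.le)
    have : (L : ℝ) * ∑ n, ‖a n‖ ^ 2 ≤ (L : ℝ) * Fintype.card G :=
      mul_le_mul_of_nonneg_left hnorm hLR.le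
    linarith
  have hsum : ∑ ℓ ∈ Ico 1 L, (1 - (ℓ : ℝ) / L) *
      ((∑ n, a n * (starRingEnd ℂ) (a (n + ℓ • v))).re / Fintype.card G) =
        1 / ((L : ℝ) * Fintype.card G) * B := by
    rw [hB, Finset.mul_sum]
    refine Finset.sum_congr rfl fun ℓ _ => ?_
    field_simp
  rw [hsum]
  have hR : (1 / (L : ℝ) + 2 / L * (1 / ((L : ℝ) * Fintype.card G) * B)) =
      (Fintype.card G : ℝ) * ((L : ℝ) * Fintype.card G + 2 * B) /
        ((L : ℝ) ^ 2 * (Fintype.card G : ℝ) ^ 2) := by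
    field_simp
  rw [hR, div_le_div_iff₀ (by positivity) (by positivity)]
  calc ‖∑ n, a n‖ ^ 2 * ((L : ℝ) ^ 2 * (Fintype.card G : ℝ) ^ 2)
      = ((L : ℝ) ^ 2 * ‖∑ n, a n‖ ^ 2) * (Fintype.card G : ℝ) ^ 2 := by ring
    _ ≤ ((Fintype.card G : ℝ) * ((L : ℝ) * Fintype.card G + 2 * B)) * (Fintype.card G : ℝ) ^ 2 :=
        mul_le_mul_of_nonneg_right h' (by positivity)

end Teravainen2024

end Literature.NumberTheory.Sieve
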